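import Literature.AnabelianGeometry.EtaleTheta.FrobenioidEnvelopeIso
import Mathlib.Topology.LocallyConstant.Basic

/-!
# [EtTh] §5, Lemma 5.9 (iv): `E^Π_N ⥲ Π^tp_Y̲[μ_N]` as an isomorphism of TOPOLOGICAL groups, and the §5 ↔ §2 dictionary (p. 332 / PDF p. 106)

Mochizuki, *The étale theta function and its Frobenioid-theoretic manifestations*, Publ. RIMS **45**
(2009) [cite: MochizukiEtTh2009, Lem 5.9 (iv) p.106 (PRIMS p.332)].  Layer L2 of the abc-iut cell,
seat abc-iut-L2-t11 (wave-2 unit W2-L2-07, light discharge of §5), over abc-iut-L2-t4's files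
(`FrobenioidTheta.lean` … `FrobenioidEnvelopeIso.lean`) and abc-iut-L2-t2's `MonoThetaEnv.lean`.

Lemma 5.9 (iv) asserts that "the natural inclusions `μ_N(B_N) ↪ E_N`, `Im(Π^tp_Y) ⊆ E_N` determine an
isomorphism of topological groups `E^Π_N ⥲ Π^tp_Y[μ_N]`" (p.106 (PRIMS p.332)), where "`E_N`, `E^Π_N`
are equipped with the evident topologies".  abc-iut-L2-t4 CONSTRUCTED the group isomorphism
(`ThetaFrobenioid.envIso`) and recorded that continuity was not treated.  This file
(1) DISCHARGES the topological clause: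
* `isLocallyConstant_unitPart` — the `μ_N(B_N)`-component `x = (e, y) ↦ e · s^⊓-gp_N(ρ y)⁻¹` of
  `E^Π_N` is locally constant for the "evident topology" (`epinTopology`: `Aut_C(B_N)` discrete ×
  `Π^tp_X̲`); no continuity of `ρ` is needed in this direction since on `E^Π_N`, `ρ(y) = e^bs`;
* `continuous_envHom`, `continuous_envIso_symm`, `envContIso : E^Π_N ≃ₜ* Π^tp_Y̲[μ_N]` — the inverse
  uses that the representative `ρ : Π^tp_X̲ → Aut_D(B_N^bs)` of "the natural surjective outer
  homomorphism `Π^tp_X ↠ Aut_D(B_N^bs)` [cf. Definition 4.1, (ii)]" (p.105 (PRIMS p.331)) has OPEN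
  kernel (abc-iut-L2-t4's field `isOpen_ker_ρ`, added at this seat's request: in print `B_N^bs` is a
  Galois object of the connected temperoid `D`, "normal open subgroups `H ⊆ Π^tp_X`", §4 p.86
  (PRIMS p.312));
(2) records, as NAMED HYPOTHESES each quoting a printed sentence, the rest of the §5 ↔ §2 dictionary
that the bi-theta-environment clause of Lemma 5.9 (iv) consumes (used by the proof-only companion
`Discharge/Sec5BiThetaIso.lean`): `IdentifiesPiYdd` (twin of abc-iut-L2-t4's `IdentifiesPiY`),
`CyclotomicCharacterCompatX` (their `CyclotomicCharacterCompat` on all of `Π^tp_X̲`, needed for the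
outer `l·ℤ`-action), `ThetaSectionCompat` (Prop. 5.2 (iii) in abc-iut-L2-t2's coordinates), and the
`K^×`-part of `D ↦ D_Y` (Lemma 5.8 / Def. 2.13 (i)) as `ConstOutTransported` / `KummerOutReached`.
HONEST FRAMING: discharges are MODULO the named hypotheses listed in each theorem; [EtTh] is a
refereed paper, nothing of it is asserted unconditionally here; typed ≠ proved; no side is taken on
any disputed claim downstream.
-/

namespace Literature.AnabelianGeometry.EtaleTheta

open CategoryTheory

universe w v v' u u'

/-- A homomorphism out of a topological group whose kernel is open is locally constant (it is
constant on the open cosets of its kernel).  Used for `ρ : Π^tp_X̲ → Aut_D(B_N^bs)`.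
[cite: MochizukiEtTh2009, Lem 5.9 (iv) p.106 (PRIMS p.332)] -/
private theorem MonoidHom.isLocallyConstant_of_isOpen_ker {G H : Type*} [Group G]
    [TopologicalSpace G] [ContinuousMul G] [Group H] (f : G →* H)
    (hf : IsOpen ((f.ker : Subgroup G) : Set G)) : IsLocallyConstant f := by
  rw [IsLocallyConstant.iff_exists_open]
  intro x
  refine ⟨(fun y => x⁻¹ * y) ⁻¹' (f.ker : Set G), hf.preimage (by fun_prop), by simp, ?_⟩
  intro y hy
  have h : f (x⁻¹ * y) = 1 := by simpa [MonoidHom.mem_ker] using hy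
  rw [map_mul, map_inv, inv_mul_eq_one] at h
  exact h.symm

namespace ThetaFrobenioid

variable {C : Type u} [Category.{v} C] {D : Type u'} [Category.{v'} D]
  (𝔉 : ThetaFrobenioid.{w} C D)

/-! ### The two coordinates of `E^Π_N ⊆ Aut_C(B_N) × Π^tp_X̲` for the "evident topology" -/

/-- The coordinate `E^Π_N → Aut_C(B_N)`, `(e, y) ↦ e`, is locally constant (`Aut_C(B_N)` is given the
discrete topology in `epinTopology`, p.106 (PRIMS p.332) "equipped with the evident topologies").
[cite: MochizukiEtTh2009, Lem 5.9 (iv) p.106 (PRIMS p.332)] -/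
theorem isLocallyConstant_toAut :
    IsLocallyConstant fun x : 𝔉.EPiN => (x : Aut 𝔉.BN × 𝔉.PiX).1 := by
  letI : TopologicalSpace (Aut 𝔉.BN) := 𝔉.autDiscrete
  haveI : DiscreteTopology (Aut 𝔉.BN) := ⟨rfl⟩
  letI : TopologicalSpace (Aut 𝔉.BN × 𝔉.PiX) := 𝔉.ambientTopology
  rw [IsLocallyConstant.iff_continuous]
  exact continuous_fst.comp continuous_induced_dom

/-- The coordinate `E^Π_N → Π^tp_X̲`, `(e, y) ↦ y`, is continuous.
[cite: MochizukiEtTh2009, Lem 5.9 (iv) p.106 (PRIMS p.332)] -/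
theorem continuous_toPiX : Continuous fun x : 𝔉.EPiN => (x : Aut 𝔉.BN × 𝔉.PiX).2 := by
  letI : TopologicalSpace (Aut 𝔉.BN) := 𝔉.autDiscrete
  letI : TopologicalSpace (Aut 𝔉.BN × 𝔉.PiX) := 𝔉.ambientTopology
  exact continuous_snd.comp continuous_induced_dom

/-- `E^Π_N ↠ Π^tp_Y̲` (abc-iut-L2-t4's `toPiY`) is continuous.
[cite: MochizukiEtTh2009, Lem 5.9 (iv) p.106 (PRIMS p.332)] -/
theorem continuous_toPiY : Continuous 𝔉.toPiY := 𝔉.continuous_toPiX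

/-- The `μ_N(B_N)`-component `x = (e, y) ↦ e · s^⊓-gp_N(ρ y)⁻¹` of `E^Π_N` (abc-iut-L2-t4's
`unitPart`) is locally constant: on `E^Π_N` one has `ρ(y) = e^bs`, so it is a function of the
discrete coordinate `e` alone.  [cite: MochizukiEtTh2009, Lem 5.9 (iv) p.106 (PRIMS p.332)] -/
theorem isLocallyConstant_unitPart (H : 𝔉.Facts) :
    IsLocallyConstant fun x : 𝔉.EPiN => (𝔉.unitPart H x : Aut 𝔉.BN) := by
  have key : (fun x : 𝔉.EPiN => (𝔉.unitPart H x : Aut 𝔉.BN)) =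
      (fun a : Aut 𝔉.BN => a * (𝔉.sgpCap (𝔉.autBase 𝔉.BN a))⁻¹) ∘
        fun x : 𝔉.EPiN => (x : Aut 𝔉.BN × 𝔉.PiX).1 := by
    funext x
    simp only [Function.comp_apply, coe_unitPart]
    rw [x.2.2.2]
  rw [key]
  exact 𝔉.isLocallyConstant_toAut.comp _

/-! ### Continuity of `E^Π_N → Π^tp_Y[μ_N]` and of its inverse -/

/-- **Lemma 5.9 (iv), continuity of `E^Π_N → Π^tp_Y[μ_N]`** (`envHom` of abc-iut-L2-t4), for the
evident topology on `E^Π_N` and the topology `μ_N × Π^tp_Y` on the cyclotomic envelope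
(abc-iut-L2-t2's `ThetaEnvData.env`), given a CONTINUOUS identification `ι : Π^tp_X̲ → Π^tp_X`.
[cite: MochizukiEtTh2009, Lem 5.9 (iv) p.106 (PRIMS p.332)] -/
theorem continuous_envHom (H : 𝔉.Facts) (T : ThetaEnvData.{v} 𝔉.N) (ι : 𝔉.PiX ≃* T.PiX)
    (hι : Continuous ι) (m : 𝔉.muTorsion 𝔉.BN 𝔉.N ≃* T.mu) (hY : 𝔉.IdentifiesPiY T ι)
    (hχ : 𝔉.CyclotomicCharacterCompat T ι m) : Continuous (𝔉.envHom H T ι m hY hχ) := by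
  apply continuous_induced_rng.2
  change Continuous fun x : 𝔉.EPiN =>
    ((𝔉.envHom H T ι m hY hχ x).left, (𝔉.envHom H T ι m hY hχ x).right)
  refine Continuous.prodMk ?_ ?_
  · have hl : IsLocallyConstant fun x : 𝔉.EPiN => m (𝔉.unitPart H x) :=
      ((𝔉.isLocallyConstant_unitPart H).desc _ Subtype.val Subtype.val_injective).comp m
    exact hl.continuous
  · change Continuous fun x : 𝔉.EPiN => (⟨ι x.1.2, (hY _).mp x.2.2.1⟩ : T.PiY)
    exact (hι.comp 𝔉.continuous_toPiX).subtype_mk _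

/-- The inverse of `envIso` in coordinates: `(a, p) ↦ (m⁻¹(a) · s^⊓-gp_N(ρ(ι⁻¹ p)), ι⁻¹ p)`.
[cite: MochizukiEtTh2009, Lem 5.9 (iv) p.106 (PRIMS p.332)] -/
theorem envIso_symm_coe (H : 𝔉.Facts) (T : ThetaEnvData.{v} 𝔉.N) (ι : 𝔉.PiX ≃* T.PiX)
    (m : 𝔉.muTorsion 𝔉.BN 𝔉.N ≃* T.mu) (hY : 𝔉.IdentifiesPiY T ι)
    (hχ : 𝔉.CyclotomicCharacterCompat T ι m) (z : T.env) :
    (((𝔉.envIso H T ι m hY hχ).symm z : 𝔉.EPiN) : Aut 𝔉.BN × 𝔉.PiX) =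
      ((m.symm z.left : 𝔉.muTorsion 𝔉.BN 𝔉.N) * 𝔉.sgpCap (𝔉.ρ (ι.symm (z.right : T.PiX))),
        ι.symm (z.right : T.PiX)) := by
  set x := (𝔉.envIso H T ι m hY hχ).symm z with hx
  have hz : 𝔉.envHom H T ι m hY hχ x = z := (𝔉.envIso H T ι m hY hχ).apply_symm_apply z
  have h2 : ι (x : Aut 𝔉.BN × 𝔉.PiX).2 = (z.right : T.PiX) := by
    rw [← hz]; rfl
  have h1 : m (𝔉.unitPart H x) = z.left := by
    rw [← hz]; rfl
  have h2' : (x : Aut 𝔉.BN × 𝔉.PiX).2 = ι.symm (z.right : T.PiX) := by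
    rw [← h2, MulEquiv.symm_apply_apply]
  have h1' : ((𝔉.unitPart H x : 𝔉.muTorsion 𝔉.BN 𝔉.N) : Aut 𝔉.BN) =
      (m.symm z.left : 𝔉.muTorsion 𝔉.BN 𝔉.N) := by
    rw [← h1, MulEquiv.symm_apply_apply]
  rw [coe_unitPart] at h1'
  refine Prod.ext ?_ h2'
  rw [← h2', ← h1', inv_mul_cancel_right]

/-- **Lemma 5.9 (iv), continuity of `(E^Π_N ⥲ Π^tp_Y[μ_N])⁻¹`**, given `ι⁻¹` continuous and the open
kernel of `ρ` (`isOpen_ker_ρ`): the `Aut_C(B_N)`-coordinate `m⁻¹(a) · s^⊓-gp_N(ρ(ι⁻¹ p))` of the inverse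
is locally constant, the `Π^tp_X̲`-coordinate is `ι⁻¹ p`.
[cite: MochizukiEtTh2009, Lem 5.9 (iv) p.106 (PRIMS p.332)] -/
theorem continuous_envIso_symm (H : 𝔉.Facts) (T : ThetaEnvData.{v} 𝔉.N) (ι : 𝔉.PiX ≃* T.PiX)
    (hι' : Continuous ι.symm) (m : 𝔉.muTorsion 𝔉.BN 𝔉.N ≃* T.mu) (hY : 𝔉.IdentifiesPiY T ι)
    (hχ : 𝔉.CyclotomicCharacterCompat T ι m) :
    Continuous (𝔉.envIso H T ι m hY hχ).symm := by
  letI : TopologicalSpace (Aut 𝔉.BN) := 𝔉.autDiscrete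
  haveI : DiscreteTopology (Aut 𝔉.BN) := ⟨rfl⟩
  letI : TopologicalSpace (Aut 𝔉.BN × 𝔉.PiX) := 𝔉.ambientTopology
  apply continuous_induced_rng.2
  have hfun : ((fun x : 𝔉.EPiN => (x : Aut 𝔉.BN × 𝔉.PiX)) ∘
        fun z => (𝔉.envIso H T ι m hY hχ).symm z) =
      fun z : T.env => (((m.symm z.left : 𝔉.muTorsion 𝔉.BN 𝔉.N) : Aut 𝔉.BN) *
        𝔉.sgpCap (𝔉.ρ (ι.symm (z.right : T.PiX))), ι.symm (z.right : T.PiX)) := by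
    funext z
    exact 𝔉.envIso_symm_coe H T ι m hY hχ z
  rw [hfun]
  have hright : Continuous fun z : T.env => ι.symm (z.right : T.PiX) :=
    hι'.comp (continuous_subtype_val.comp
      (continuous_snd.comp continuous_induced_dom :
        Continuous (Prod.snd ∘ fun x : T.env => (x.left, x.right))))
  refine Continuous.prodMk ?_ hright
  apply IsLocallyConstant.continuous
  have hl : IsLocallyConstant fun z : T.env => z.left :=
    (IsLocallyConstant.iff_continuous _).2
      (continuous_fst.comp continuous_induced_dom :
        Continuous (Prod.fst ∘ fun x : T.env => (x.left, x.right)))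
  have hr : IsLocallyConstant fun z : T.env => 𝔉.ρ (ι.symm (z.right : T.PiX)) :=
    (MonoidHom.isLocallyConstant_of_isOpen_ker 𝔉.ρ 𝔉.isOpen_ker_ρ).comp_continuous hright
  exact hl.comp₂ hr fun a g => (((m.symm a : 𝔉.muTorsion 𝔉.BN 𝔉.N) : Aut 𝔉.BN) * 𝔉.sgpCap g)

/-- **[EtTh] Lemma 5.9 (iv), "an isomorphism of topological groups `E^Π_N ⥲ Π^tp_Y[μ_N]`"**
(p.106 (PRIMS p.332)) — abc-iut-L2-t4's group isomorphism `envIso` upgraded to an isomorphism of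
TOPOLOGICAL groups, for a continuous identification `ι : Π^tp_X̲ ≃ₜ* Π^tp_X` of the two interfaces,
modulo `Facts`, `IdentifiesPiY`, `CyclotomicCharacterCompat`.
[cite: MochizukiEtTh2009, Lem 5.9 (iv) p.106 (PRIMS p.332)] -/
noncomputable def envContIso (H : 𝔉.Facts) (T : ThetaEnvData.{v} 𝔉.N) (ι : 𝔉.PiX ≃ₜ* T.PiX)
    (m : 𝔉.muTorsion 𝔉.BN 𝔉.N ≃* T.mu) (hY : 𝔉.IdentifiesPiY T ι.toMulEquiv)
    (hχ : 𝔉.CyclotomicCharacterCompat T ι.toMulEquiv m) :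
    𝔉.EPiN ≃ₜ* T.env :=
  ContinuousMulEquiv.mk (𝔉.envIso H T ι.toMulEquiv m hY hχ)
    (𝔉.continuous_envHom H T ι.toMulEquiv ι.continuous m hY hχ)
    (𝔉.continuous_envIso_symm H T ι.toMulEquiv ι.symm.continuous m hY hχ)

/-- `envContIso` is `envIso` on elements. [cite: MochizukiEtTh2009, Lem 5.9 (iv) p.106 (PRIMS p.332)] -/
@[simp] theorem envContIso_apply (H : 𝔉.Facts) (T : ThetaEnvData.{v} 𝔉.N) (ι : 𝔉.PiX ≃ₜ* T.PiX)
    (m : 𝔉.muTorsion 𝔉.BN 𝔉.N ≃* T.mu) (hY : 𝔉.IdentifiesPiY T ι.toMulEquiv)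
    (hχ : 𝔉.CyclotomicCharacterCompat T ι.toMulEquiv m) (x : 𝔉.EPiN) :
    𝔉.envContIso H T ι m hY hχ x = 𝔉.envIso H T ι.toMulEquiv m hY hχ x := rfl

/-- `envContIso` has underlying group isomorphism `envIso`.
[cite: MochizukiEtTh2009, Lem 5.9 (iv) p.106 (PRIMS p.332)] -/
theorem envContIso_toMulEquiv (H : 𝔉.Facts) (T : ThetaEnvData.{v} 𝔉.N) (ι : 𝔉.PiX ≃ₜ* T.PiX)
    (m : 𝔉.muTorsion 𝔉.BN 𝔉.N ≃* T.mu) (hY : 𝔉.IdentifiesPiY T ι.toMulEquiv)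
    (hχ : 𝔉.CyclotomicCharacterCompat T ι.toMulEquiv m) :
    (𝔉.envContIso H T ι m hY hχ).toMulEquiv = 𝔉.envIso H T ι.toMulEquiv m hY hχ := rfl

/-- The topological isomorphism is compatible with the projections to `Π^tp_Y̲`:
`proj ∘ envContIso = ι ∘ (E^Π_N ↠ Π^tp_Y̲)`.  [cite: MochizukiEtTh2009, Lem 5.9 (iv) p.106 (PRIMS p.332)] -/
theorem envContIso_proj (H : 𝔉.Facts) (T : ThetaEnvData.{v} 𝔉.N) (ι : 𝔉.PiX ≃ₜ* T.PiX)
    (m : 𝔉.muTorsion 𝔉.BN 𝔉.N ≃* T.mu) (hY : 𝔉.IdentifiesPiY T ι.toMulEquiv)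
    (hχ : 𝔉.CyclotomicCharacterCompat T ι.toMulEquiv m) (x : 𝔉.EPiN) :
    ((CycEnvelope.proj T.augY T.chi (𝔉.envContIso H T ι m hY hχ x) : T.PiY) : T.PiX) =
      ι (𝔉.toPiY x) :=
  rfl

/-! ### The §5 ↔ §2 dictionary consumed by the bi-theta-environment clause (named hypotheses) -/

/-- The identification `ι : Π^tp_X̲ ≃ Π^tp_X` "carries `Π^tp_Ÿ̲` onto `Π^tp_Ÿ`" (the same subgroup in
the two interfaces; twin of abc-iut-L2-t4's `IdentifiesPiY`; `TODO-merge(abc-iut-L2-t2)`).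
[cite: MochizukiEtTh2009, Lem 5.9 (iv) p.106 (PRIMS p.332)] -/
def IdentifiesPiYdd (T : ThetaEnvData.{v} 𝔉.N) (ι : 𝔉.PiX ≃* T.PiX) : Prop :=
  ∀ y : 𝔉.PiX, y ∈ 𝔉.PiYdd ↔ ι y ∈ T.PiYdd

/-- "`Π^tp_X` [i.e., `G_K`, via `Π^tp_X ↠ G_K`] acts [on `μ_N(B_N)`] via multiplication by" the
cyclotomic character: conjugation by `s^⊓-gp_N(ρ g)` on `μ_N(B_N)` is `χ(aug(ι g))` under
`m : μ_N(B_N) ≃ μ_N`, for ALL `g ∈ Π^tp_X̲` (abc-iut-L2-t4's `CyclotomicCharacterCompat` is the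
restriction to `Π^tp_Y̲`; the outer `l·ℤ`-action of Lemma 5.9 (iii) needs all of `Π^tp_X̲`).
Arithmetic FACT ([FrdII] Def. 2.1 (i), Thm. 2.4).  [cite: MochizukiEtTh2009, Lem 5.8 proof p.105 (PRIMS p.331)] -/
def CyclotomicCharacterCompatX (T : ThetaEnvData.{v} 𝔉.N) (ι : 𝔉.PiX ≃* T.PiX)
    (m : 𝔉.muTorsion 𝔉.BN 𝔉.N ≃* T.mu) : Prop :=
  ∀ (g : 𝔉.PiX) (u u' : 𝔉.muTorsion 𝔉.BN 𝔉.N),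
    (u' : Aut 𝔉.BN) = 𝔉.sgpCap (𝔉.ρ g) * u * (𝔉.sgpCap (𝔉.ρ g))⁻¹ → m u' = T.chi (T.aug (ι g)) (m u)

/-- The `Π^tp_X̲`-version restricts to abc-iut-L2-t4's `Π^tp_Y̲`-version.
[cite: MochizukiEtTh2009, Lem 5.8 proof p.105 (PRIMS p.331)] -/
theorem CyclotomicCharacterCompatX.toY {T : ThetaEnvData.{v} 𝔉.N} {ι : 𝔉.PiX ≃* T.PiX}
    {m : 𝔉.muTorsion 𝔉.BN 𝔉.N ≃* T.mu} (h : 𝔉.CyclotomicCharacterCompatX T ι m) :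
    𝔉.CyclotomicCharacterCompat T ι m :=
  fun y _ u u' hu => h y u u' hu

/-- The bi-Kummer difference cocycle `h ↦ s^⊔-gp_N(ρ h) · s^⊓-gp_N(ρ h)⁻¹` on `Π^tp_Ÿ̲`, valued in
`μ_N(B_N)` by Prop. 4.3 (iii) (abc-iut-L2-t4's `BiKummerDifferenceMem`).
[cite: MochizukiEtTh2009, Prop 5.2 (iii) p.98 (PRIMS p.324)] -/
def diffCocycle (H : 𝔉.Facts) (h : 𝔉.PiYdd) : 𝔉.muTorsion 𝔉.BN 𝔉.N :=
  ⟨𝔉.sgpCup (𝔉.rhoYdd h) * (𝔉.sgpCap (𝔉.rhoYdd h : Aut (𝔉.base.obj 𝔉.BN)))⁻¹,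
    H.biKummerDifferenceMem _⟩

/-- The `μ_N(B_N)`-component of `s^⊔-Π_N(h) = (s^⊔-gp_N(ρ h), h)` is the difference cocycle at `h`.
[cite: MochizukiEtTh2009, Lem 5.9 (iv) p.106 (PRIMS p.332)] -/
theorem unitPart_sCupPi (H : 𝔉.Facts) (h1 : 𝔉.SectionsFactor) (hcs : 𝔉.SgpCupSection)
    (h : 𝔉.PiYdd) : 𝔉.unitPart H (𝔉.sCupPi h1 hcs h) = 𝔉.diffCocycle H h :=
  Subtype.ext rfl

/-- **Prop. 5.2 (iii) in the coordinates of the model** (the §5 ↔ §2 dictionary for `s^Θ`): "the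
Kummer class determined by the bi-Kummer `N`-th root … corresponds precisely to the reduction modulo
`N` of the class `η̲̈^Θ` … relative to the natural isomorphism between `μ_N(−)` and `(l·Δ_Θ) ⊗ ℤ/Nℤ`"
(p.98 (PRIMS p.324)), read through `m : μ_N(B_N) ≃ μ_N` and `ι|Π^tp_Ÿ̲`: the difference cocycle IS
(the inverse of) the cocycle `η` from which the model theta section `s^Θ_Ÿ = η⁻¹ · s^alg_Ÿ` (p.46)
is built.  Named hypothesis; to be derived from abc-iut-L2-t4's `ThetaPairKummerClass` once the two
interfaces are merged (`TODO-merge(abc-iut-L2-t2, abc-iut-L2-t4)`).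
[cite: MochizukiEtTh2009, Prop 5.2 (iii) p.98 (PRIMS p.324)] -/
def ThetaSectionCompat (H : 𝔉.Facts) (T : ThetaEnvData.{v} 𝔉.N) (ι : 𝔉.PiX ≃* T.PiX)
    (m : 𝔉.muTorsion 𝔉.BN 𝔉.N ≃* T.mu) (hYdd : 𝔉.IdentifiesPiYdd T ι) (η : T.PiYdd → T.mu) :
    Prop :=
  ∀ h : 𝔉.PiYdd, m (𝔉.diffCocycle H h) = (η ⟨ι h, (hYdd h).mp h.2⟩)⁻¹

/-- **The `K^×`-part of `D ↦ D_Y`, first half (named hypothesis)**: the transported outer actions of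
the constants `(O_K^×)^{1/N}` (Lemma 5.8: "a natural outer action of `(O_K^×)^{1/N}/μ_N(B_N) ⥲ O_K^×`
on `E_N` … extends to … `K^×`"; abc-iut-L2-t4's `constOut` and its parameter `DK` for the `K^×`-part)
lie in `D_Y` — in print they ARE the Kummer classes of constants generating `D_Y` together with
`Gal(Y/X)` (Def. 2.13 (i) p.47).  Arithmetic (Kummer theory of `K`); `TODO-merge(abc-iut-L2-t2/t4)`.
[cite: MochizukiEtTh2009, Lem 5.8 p.105 (PRIMS p.331)] -/
def ConstOutTransported (H : 𝔉.Facts) (h8 : 𝔉.ConstantsEqNormalizer) (DK : Set (TopOut 𝔉.EPiN))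
    (T : ThetaEnvData.{v} 𝔉.N) (ι : 𝔉.PiX ≃ₜ* T.PiX) (m : 𝔉.muTorsion 𝔉.BN 𝔉.N ≃* T.mu)
    (hY : 𝔉.IdentifiesPiY T ι.toMulEquiv) (hχ : 𝔉.CyclotomicCharacterCompat T ι.toMulEquiv m)
    : Prop :=
  TopOut.transport (𝔉.envContIso H T ι m hY hχ) '' (𝔉.constOut h8 ∪ DK) ⊆ (T.DY : Set _)

/-- **The `K^×`-part of `D ↦ D_Y`, second half (named hypothesis)**: every Kummer outer automorphism
of `Π^tp_Y[μ_N]` (abc-iut-L2-t2's `kummerOut`: shifts by `μ_N`-valued cocycles inflated from `G_K`,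
"the image of `K^×`", Def. 2.13 (i) p.47) is reached from `D ⊆ Out(E^Π_N)` (Lemma 5.8: the outer
action "extends to an outer action of `(K^×)^{1/N}/μ_N(B_N) ⥲ K^×`").  Arithmetic;
`TODO-merge(abc-iut-L2-t2/t4)`.  [cite: MochizukiEtTh2009, Lem 5.8 p.105 (PRIMS p.331)] -/
def KummerOutReached (H : 𝔉.Facts) (h1 : 𝔉.SectionsFactor) (h3 : 𝔉.OuterActionLZ)
    (hsec : 𝔉.SgpCapSection) (hcs : 𝔉.SgpCupSection) (h8 : 𝔉.ConstantsEqNormalizer)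
    (DK : Set (TopOut 𝔉.EPiN)) (T : ThetaEnvData.{v} 𝔉.N) (ι : 𝔉.PiX ≃ₜ* T.PiX)
    (m : 𝔉.muTorsion 𝔉.BN 𝔉.N ≃* T.mu) (hY : 𝔉.IdentifiesPiY T ι.toMulEquiv)
    (hχ : 𝔉.CyclotomicCharacterCompat T ι.toMulEquiv m) : Prop :=
  T.kummerOut ⊆ ((𝔉.frdBiThetaEnv h1 h3 hsec hcs h8 DK).D.map
    (TopOut.transport (𝔉.envContIso H T ι m hY hχ)) : Set _)

end ThetaFrobenioid

end Literature.AnabelianGeometry.EtaleTheta
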